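import Literature.Computability.AlgebraicComplexity.PermanentBitsPPoly
import Literature.Computability.QuantumComplexity.PermanentHardness
import Literature.Computability.Complexity.IndexAllBricks
import Literature.Computability.Complexity.ListFoldBricks
import Literature.Computability.Complexity.IsqrtBrick
import Literature.Computability.Complexity.IntVectorBricks
import Literature.Computability.Complexity.OracleClosure
import HarnessLib

/-!
# The two transcriptions of Valiant's `0/1`-permanent theorem are equivalent (polynomial-time transcoders)

Valiant's theorem (*The complexity of computing the permanent*, TCS 8 (1979), Thm. 1: "computing
the permanent of a (0,1)-matrix is `#P`-complete", hardness under polynomial-time Turing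
reductions) is recorded in the tree as two named facts that differ only in the bit-level input
convention, which the printed statement does not fix:

* `Literature.Computability.QuantumComplexity.permanent01_isSharpPHardFun` (`PermanentHardness.lean`):
  `IsSharpPHardFun per01Fn`, square integer matrices in the structured code `encodingIntMatrix`
  (the input format of Aaronson–Arkhipov, Thm. 4.2);
* `Literature.Computability.AlgebraicComplexity.Valiant1979_per01Plain_isSharpPHardFun`
  (`PermanentBitsPPoly.lean`): `IsSharpPHardFun per01PlainFn`, an `n × n` `0/1` matrix being the
  word of its `n²` entries in row-major order (the convention circuits can read; it feeds
  Bürgisser's Lemma 2.12 and the τ-conjecture transfer theorems, `TauConjectureTwoFacts.lean`).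

`PermanentBitsPPoly.lean` recorded that "the tree has no polynomial-time transcoder between the
two formats". This file supplies both transcoders as `FP` bricks and proves the two facts
EQUIVALENT (`Valiant1979_per01Plain_isSharpPHardFun_iff_permanent01`), indeed
`FP^{per01PlainFn} = FP^{per01Fn}` and `P^{per01PlainFn} = P^{per01Fn}`; whichever transcription
is discharged first discharges the other.

* **Structured code → row-major word** (`toPlainFn`, the delicate direction: an `FP^{per01Fn}`
  machine may ask ARBITRARY strings, so the simulation must reproduce `per01Fn` on malformed
  codes too). `encodingIntMatrix.decode` is analysed totally (`encodingIntMatrix_decode`: it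
  succeeds iff the row fuel equals the dimension header and every row has that fuel, `CodeOK`;
  the entries are then read by the total `intOfCode` = sign bit and `decodeNat` of the magnitude,
  `listBoolDecode_eq`), which gives the value of `per01Fn` on every string (`per01Fn_eq`). The
  transcoder tests exactly this (`chkDim`: canonical numeral of the header against the binary
  length of the fuel, `decodeNat_eq_iff_canonF`; `chkRows`, `chk01`: index-all loops
  `Brick.allIdxFn` over rows and entries) and writes the row-major word by two nested
  concatenation folds (`Brick.foldLoop appF`), or the word `00` of non-square length
  (`toPlainFn_apply : toPlainFn w = toPlainSpec w`, `per01PlainFn_toPlainFn :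
  per01PlainFn (toPlainFn w) = per01Fn w`).
* **Row-major word → structured code** (`toCodeFn`, the easy direction: encode). The integer
  square root of the length (`isqrtFn`), the square test, and the code written flat
  (`encode_sq_eq`: header `bin n`, fuel `1ⁿ`, `ccat` of row codes) by two nested folds, entries
  read by `bitAtFn` at the position `i n + j` (`posS`, `binToUnaryFn`); non-square words go to
  the code of the `1 × 1` zero matrix (`per01Fn_toCodeFn : per01Fn (toCodeFn w) = per01PlainFn w`).
* Consequences: `ofFun_per01Fn_mem_FPRel`, `ofFun_per01PlainFn_mem_FPRel` (one query through the
  transcoder, `self_mem_FPRel`, `comp_FP_mem_FPRel`), `FPRel_per01Plain_eq`, `PRel_per01Plain_eq`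
  (`OracleAlg.FPRel_subset_FPRel_of_mem_FPRel`), `isSharpPHardFun_per01Plain_iff`,
  `Valiant1979_per01Plain_isSharpPHardFun_of_permanent01`,
  `permanent01_isSharpPHardFun_of_per01Plain`,
  `Valiant1979_per01Plain_isSharpPHardFun_iff_permanent01`.

## References

* L. G. Valiant, *The complexity of computing the permanent*, Theoret. Comput. Sci. 8 (1979)
  189–201, Thm. 1.
* S. Aaronson, A. Arkhipov, *The computational complexity of linear optics*, Theory of
  Computing 9 (2013), Thm. 4.2 (the input format `encodingIntMatrix`).
* S. Arora, B. Barak, *Computational Complexity: A Modern Approach*, CUP 2009, §0.1 (codes),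
  §1.3 (closure of polynomial time under composition and bounded loops), §17.2 (`FP^{#P}`).
-/

noncomputable section

namespace Literature.Computability.AlgebraicComplexity

open _root_.Computability Complexity Literature.Computability.QuantumComplexity Brick PRelSigPi

/-! ### Total decoding of `encodingIntMatrix` codes -/

/-- The integer read off an arbitrary string by `encodingIntBool.decode` (sign–magnitude: the head
bit of the first component is the sign, the second component is read by `decodeNat`). [folklore] -/
def intOfCode (v : List Bool) : ℤ :=
  if decodeBool (fstP v) then -(decodeNat (sndP v) : ℤ) else (decodeNat (sndP v) : ℤ)

/-- `encodingIntBool` decodes every string, to `intOfCode`. [folklore] -/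
theorem encodingIntBool_decode (v : List Bool) : encodingIntBool.decode v = some (intOfCode v) := by
  simp [encodingIntBool, Encoding.pairBool, encodingBoolBool, encodingNatBool, intOfCode, fstP, sndP]

/-- **The fuel-indexed list decoder, totally**: it succeeds iff every item `elemOf w i`, `i < n`,
decodes, and then returns the list of the decoded items. [folklore] -/
theorem listBoolDecode_eq {α : Type} (e : Encoding α Bool) :
    ∀ (n : ℕ) (w : List Bool), listBoolDecode e n w =
      if h : ∀ i : Fin n, ((e.decode (elemOf w i)).isSome : Prop) then
        some (List.ofFn fun i : Fin n => (e.decode (elemOf w i)).get (h i))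
      else none
  | 0, w => by simp [listBoolDecode]
  | n + 1, w => by
    rw [listBoolDecode]
    have ih := listBoolDecode_eq e n (boolUnpair w).2
    cases hd : e.decode (boolUnpair w).1 with
    | none =>
      have h0 : ¬ ∀ i : Fin (n + 1), ((e.decode (elemOf w i)).isSome : Prop) := fun h => by
        have := h 0
        rw [Fin.val_zero, Brick.elemOf_zero, fstP, hd] at this
        exact Bool.false_ne_true this
      rw [dif_neg h0]
      rfl
    | some a =>
      simp only [Option.bind_eq_bind, Option.bind_some]
      change (listBoolDecode e n (boolUnpair w).2).bind (fun l => some (a :: l)) = _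
      rw [ih]
      by_cases h : ∀ i : Fin n, ((e.decode (elemOf (boolUnpair w).2 i)).isSome : Prop)
      · have h' : ∀ i : Fin (n + 1), ((e.decode (elemOf w i)).isSome : Prop) := by
          intro i
          refine Fin.cases ?_ (fun j => ?_) i
          · rw [Fin.val_zero, Brick.elemOf_zero, fstP, hd]; rfl
          · rw [Fin.val_succ, Brick.elemOf_succ]; exact h j
        rw [dif_pos h, dif_pos h', Option.bind_some, List.ofFn_succ]
        congr 2
        · have : e.decode (elemOf w ((0 : Fin (n + 1)) : ℕ)) = some a := by
            rw [Fin.val_zero, Brick.elemOf_zero, fstP, hd]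
          simp only [this, Option.get_some]
      · have h' : ¬ ∀ i : Fin (n + 1), ((e.decode (elemOf w i)).isSome : Prop) := fun h' => h fun j => by
          have := h' j.succ
          rwa [Fin.val_succ, Brick.elemOf_succ] at this
        rw [dif_neg h, dif_neg h']
        rfl

/-- The dimension header of a matrix code, read by `decodeNat`. [folklore] -/
def codeDim (w : List Bool) : ℕ := decodeNat (fstP w)

/-- The fuel of the row list of a matrix code (the length of its unary header). [folklore] -/
def codeFuel (w : List Bool) : ℕ := (fstP (sndP w)).length

/-- The body of the row list of a matrix code. [folklore] -/
def codeRows (w : List Bool) : List Bool := sndP (sndP w)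

/-- The string coding entry `(i, j)` of a matrix code (total: `ε` out of range). [folklore] -/
def codeEntry (w : List Bool) (i j : ℕ) : List Bool := elemOf (sndP (elemOf (codeRows w) i)) j

/-- The well-formedness condition under which `encodingIntMatrix.decode` succeeds: the row fuel is
the dimension and every row has the dimension as its fuel. [folklore] -/
def CodeOK (w : List Bool) : Prop :=
  codeFuel w = codeDim w ∧ ∀ i < codeDim w, (fstP (elemOf (codeRows w) i)).length = codeDim w

/-- Well-formedness is decidable. [folklore] -/
instance : DecidablePred CodeOK := fun w => by unfold CodeOK; infer_instance

/-- A row item decodes (under `encodingFinVec encodingIntBool m`) iff its fuel is `m`, to the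
vector of the integers of its entries. [folklore] -/
theorem encodingFinVec_int_decode (m : ℕ) (item : List Bool) :
    (encodingFinVec encodingIntBool m).decode item =
      if (fstP item).length = m then some (fun j : Fin m => intOfCode (elemOf (sndP item) j)) else none := by
  have hl : (encodingIntBool.listBool).decode item =
      some (List.ofFn fun i : Fin (fstP item).length => intOfCode (elemOf (sndP item) i)) := by
    change listBoolDecode encodingIntBool (unaryDecodeNat (boolUnpair item).1) (boolUnpair item).2 = _
    rw [listBoolDecode_eq]
    simp only [encodingIntBool_decode, Option.isSome_some, implies_true, dite_true, Option.get_some]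
    rfl
  change ((encodingIntBool.listBool).decode item).bind _ = _
  rw [hl, Option.bind_some]
  by_cases h : (fstP item).length = m
  · subst h
    rw [dif_pos List.length_ofFn, if_pos rfl]
    congr 1
    funext j
    simp
  · rw [dif_neg (by rw [List.length_ofFn]; exact h), if_neg h]

/-- **`encodingIntMatrix.decode`, totally**: it succeeds exactly on the well-formed codes, with the
dimension read off the header and the entries read by `intOfCode`. [folklore] -/
theorem encodingIntMatrix_decode (w : List Bool) :
    encodingIntMatrix.decode w =
      if CodeOK w then some (⟨codeDim w, fun i j => intOfCode (codeEntry w i j)⟩ : Σ n : ℕ, Fin n → Fin n → ℤ)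
      else none := by
  classical
  set m := codeDim w with hm
  have hrows : ((encodingFinVec encodingIntBool m).listBool).decode (sndP w) =
      if h : ∀ i : Fin (codeFuel w), ((fstP (elemOf (codeRows w) i)).length = m : Prop) then
        some (List.ofFn fun i : Fin (codeFuel w) => fun j : Fin m =>
          intOfCode (elemOf (sndP (elemOf (codeRows w) i)) j))
      else none := by
    change listBoolDecode _ (codeFuel w) (codeRows w) = _
    rw [listBoolDecode_eq]
    have hiff : (∀ i : Fin (codeFuel w), (((encodingFinVec encodingIntBool m).decode (elemOf (codeRows w) i)).isSome : Prop)) ↔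
        ∀ i : Fin (codeFuel w), ((fstP (elemOf (codeRows w) i)).length = m : Prop) := by
      refine forall_congr' fun i => ?_
      rw [encodingFinVec_int_decode]
      split_ifs with h <;> simp [h]
    by_cases h : ∀ i : Fin (codeFuel w), ((fstP (elemOf (codeRows w) i)).length = m : Prop)
    · rw [dif_pos (hiff.2 h), dif_pos h]
      congr 1
      refine List.ofFn_inj.2 (funext fun i => ?_)
      have hi := h i
      simp only [codeRows] at hi ⊢
      simp [encodingFinVec_int_decode, hi]
    · rw [dif_neg (fun h' => h (hiff.1 h')), dif_neg h]
  change ((((encodingFinVec encodingIntBool m).listBool).decode (sndP w)).bind fun l =>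
      if h : l.length = m then some (fun i : Fin m => l.get (Fin.cast h.symm i)) else none).map
      (Sigma.mk (β := fun n : ℕ => Fin n → Fin n → ℤ) m) = _
  rw [hrows]
  by_cases hok : CodeOK w
  · obtain ⟨hk, hall⟩ := hok
    have h : ∀ i : Fin (codeFuel w), ((fstP (elemOf (codeRows w) i)).length = m : Prop) :=
      fun i => hall i (hk ▸ i.2)
    rw [dif_pos h, Option.bind_some, if_pos ⟨hk, hall⟩]
    have hlen : (List.ofFn fun i : Fin (codeFuel w) => fun j : Fin m =>
        intOfCode (elemOf (sndP (elemOf (codeRows w) i)) j)).length = m := by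
      rw [List.length_ofFn]; exact hk
    rw [dif_pos hlen, Option.map_some]
    congr 1
    congr 1
    funext i j
    simp [codeEntry]
  · by_cases h : ∀ i : Fin (codeFuel w), ((fstP (elemOf (codeRows w) i)).length = m : Prop)
    · have hk : codeFuel w ≠ m := fun hk => hok ⟨hk, fun i hi => h ⟨i, hk ▸ hi⟩⟩
      rw [dif_pos h, Option.bind_some, dif_neg (by rw [List.length_ofFn]; exact hk), Option.map_none, if_neg hok]
    · rw [dif_neg h, Option.bind_none, Option.map_none, if_neg hok]

/-! ### The row-major word of a `0/1` matrix code and the value of `per01Fn` -/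

/-- A matrix code is a **`0/1` code** when it is well formed and all its entries are `0` or `1`
(the condition under which `per01Fn` returns a permanent). [folklore] -/
def IsZeroOneCode (w : List Bool) : Prop :=
  CodeOK w ∧ ∀ i < codeDim w, ∀ j < codeDim w,
    intOfCode (codeEntry w i j) = 0 ∨ intOfCode (codeEntry w i j) = 1

/-- The `0/1` condition is decidable. [folklore] -/
instance : DecidablePred IsZeroOneCode := fun w => by unfold IsZeroOneCode; infer_instance

/-- The entry bit `[entry (i, j) = 1]` of a matrix code. [folklore] -/
def codeBit (w : List Bool) (i j : ℕ) : Bool := decide (intOfCode (codeEntry w i j) = 1)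

/-- **The row-major word** of the matrix coded by `w`: `m` rows of `m` entry bits, concatenated
(`ccat`), `m = codeDim w`. [folklore] -/
def plainWord (w : List Bool) : List Bool :=
  ccat (fun i => ccat (fun j => [codeBit w i j]) (codeDim w)) (codeDim w)

/-- **The transcoder, specified**: the row-major word of a `0/1` code, and the word `00` (of
non-square length, so that `per01PlainFn` vanishes on it) otherwise. [folklore] -/
def toPlainSpec (w : List Bool) : List Bool :=
  if IsZeroOneCode w then plainWord w else [false, false]

/-- A `ccat` of one-letter pieces is the `List.ofFn` of the letters. [folklore] -/
theorem ccat_singleton (g : ℕ → Bool) : ∀ n : ℕ, ccat (fun j => [g j]) n = List.ofFn fun j : Fin n => g j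
  | 0 => rfl
  | n + 1 => by rw [ccat_succ, ccat_singleton g n, List.ofFn_succ', List.concat_eq_append]; rfl

/-- Length of a `ccat` of pieces of equal length. [folklore] -/
theorem length_ccat_const (g : ℕ → List Bool) {m : ℕ} (h : ∀ i, (g i).length = m) :
    ∀ n : ℕ, (ccat g n).length = n * m
  | 0 => by simp
  | n + 1 => by rw [ccat_succ, List.length_append, length_ccat_const g h n, h, Nat.succ_mul]

/-- Reading a `ccat` of pieces of equal length `m` at position `i m + j`. [folklore] -/
theorem getD_ccat_const (g : ℕ → List Bool) {m : ℕ} (h : ∀ i, (g i).length = m) (d : Bool) :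
    ∀ (n : ℕ) {i j : ℕ}, i < n → j < m → (ccat g n).getD (i * m + j) d = (g i).getD j d
  | 0, i, j, hi, _ => absurd hi (Nat.not_lt_zero _)
  | n + 1, i, j, hi, hj => by
    rw [ccat_succ]
    rcases Nat.lt_succ_iff_lt_or_eq.1 hi with hi' | rfl
    · rw [List.getD_append _ _ _ _ (by rw [length_ccat_const g h]; nlinarith), getD_ccat_const g h d n hi' hj]
    · have hlen : (ccat g i).length = i * m := length_ccat_const g h i
      rw [show i * m + j = (ccat g i).length + j by rw [hlen],
        List.getD_append_right _ _ _ _ (Nat.le_add_right _ _), Nat.add_sub_cancel_left]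

/-- The rows of the row-major word have length `m`. [folklore] -/
theorem length_row_plainWord (w : List Bool) (i : ℕ) :
    (ccat (fun j => [codeBit w i j]) (codeDim w)).length = codeDim w := by
  rw [ccat_singleton, List.length_ofFn]

/-- **The row-major word has length `m²`.** [folklore] -/
theorem length_plainWord (w : List Bool) : (plainWord w).length = codeDim w * codeDim w :=
  length_ccat_const _ (length_row_plainWord w) _

/-- **Letter `i m + j` of the row-major word is the entry bit `(i, j)`.** [folklore] -/
theorem getD_plainWord (w : List Bool) {i j : ℕ} (hi : i < codeDim w) (hj : j < codeDim w) :
    (plainWord w).getD (i * codeDim w + j) false = codeBit w i j := by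
  rw [plainWord, getD_ccat_const _ (length_row_plainWord w) false _ hi hj, ccat_singleton,
    List.getD_eq_getElem _ _ (by rw [List.length_ofFn]; exact hj), List.getElem_ofFn]

/-- The `0/1` array of the row-major word is the array of entry bits. [folklore] -/
theorem wordBits_plainWord (w : List Bool) (ij : Fin (codeDim w) × Fin (codeDim w)) :
    wordBits (plainWord w) (codeDim w) ij = codeBit w ij.1 ij.2 :=
  getD_plainWord w ij.1.2 ij.2.2

/-- For a `0/1` code, the `0/1` matrix of the row-major word is the coded matrix. [folklore] -/
theorem bitMatrix_plainWord {w : List Bool} (h : IsZeroOneCode w) :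
    bitMatrix (codeDim w) (wordBits (plainWord w) (codeDim w)) =
      Matrix.of fun i j : Fin (codeDim w) => intOfCode (codeEntry w i j) := by
  ext i j
  simp only [bitMatrix, Matrix.of_apply, wordBits_plainWord, codeBit, decide_eq_true_eq]
  rcases h.2 i i.2 j j.2 with h0 | h1
  · rw [if_neg (by rw [h0]; norm_num), h0]
  · rw [if_pos h1, h1]

/-- **The value of `per01Fn` on every string**: the permanent of the coded matrix on `0/1` codes,
`0` otherwise. [cite: Valiant1979, Thm. 1] -/
theorem per01Fn_eq (w : List Bool) :
    per01Fn w = if IsZeroOneCode w then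
      ((Matrix.of fun i j : Fin (codeDim w) => intOfCode (codeEntry w i j)).permanent).toNat else 0 := by
  unfold per01Fn
  rw [encodingIntMatrix_decode]
  by_cases hok : CodeOK w
  · simp only [hok, if_true]
    by_cases h01 : ∀ i < codeDim w, ∀ j < codeDim w,
        intOfCode (codeEntry w i j) = 0 ∨ intOfCode (codeEntry w i j) = 1
    · have hz : isZeroOneEntries ⟨codeDim w, fun i j => intOfCode (codeEntry w i j)⟩ = true := by
        simp only [isZeroOneEntries, decide_eq_true_eq]
        exact fun i j => h01 i i.2 j j.2
      rw [hz, if_pos rfl, if_pos ⟨hok, h01⟩]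
    · have hz : isZeroOneEntries ⟨codeDim w, fun i j => intOfCode (codeEntry w i j)⟩ = false := by
        simp only [isZeroOneEntries, decide_eq_false_iff_not]
        intro h
        exact h01 fun i hi j hj => h ⟨i, hi⟩ ⟨j, hj⟩
      rw [hz, if_neg (fun h => ((show ¬ IsZeroOneCode w from fun h' => h01 h'.2) h))]
      simp
  · simp only [hok, if_false]
    rw [if_neg (fun h : IsZeroOneCode w => hok h.1)]

/-- **The specified transcoder is correct**: `per01PlainFn (toPlainSpec w) = per01Fn w` on every
string `w`. [cite: Valiant1979, Thm. 1] -/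
theorem per01PlainFn_toPlainSpec (w : List Bool) : per01PlainFn (toPlainSpec w) = per01Fn w := by
  rw [per01Fn_eq, toPlainSpec]
  by_cases h : IsZeroOneCode w
  · rw [if_pos h, if_pos h, per01PlainFn, length_plainWord, Nat.sqrt_eq, if_pos rfl, bitMatrix_plainWord h]
  · rw [if_neg h, if_neg h, per01PlainFn_of_not_sq]
    have h1 : 1 ≤ Nat.sqrt 2 := Nat.le_sqrt.2 (by norm_num)
    have h2 : Nat.sqrt 2 < 2 := Nat.sqrt_lt.2 (by norm_num)
    show Nat.sqrt 2 * Nat.sqrt 2 ≠ 2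
    have h3 : Nat.sqrt 2 = 1 := by omega
    rw [h3]; norm_num

/-! ### Numeral tests -/

/-- `fstF = fstP` (the brick and the projection namespaces name the same function). [folklore] -/
theorem fstF_eq_fstP : fstF = fstP := rfl

/-- `sndF = sndP`. [folklore] -/
theorem sndF_eq_sndP : sndF = sndP := rfl

/-- **Reading a numeral through its canonical form**: `decodeNat s = n ↔ canonF s = bin n`. [folklore] -/
theorem decodeNat_eq_iff_canonF (s : List Bool) (n : ℕ) : decodeNat s = n ↔ canonF s = encodeNat n := by
  constructor
  · intro h
    rw [← encodeNat_decodeNat (isCanonicalNum_canonF s), decodeNat_canonF, h]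
  · intro h
    rw [← decodeNat_canonF, h, decode_encodeNat]

/-- `decodeBool` reads the head letter (`false` on the empty string). [folklore] -/
theorem decodeBool_eq_headD (t : List Bool) : decodeBool t = t.headD false := by
  cases t <;> rfl

/-- `intOfCode v = 1` iff the sign is `+` and the magnitude reads `1`. [folklore] -/
theorem intOfCode_eq_one_iff (v : List Bool) :
    intOfCode v = 1 ↔ canonF (sndP v) = [true] ∧ (fstP v).headD false = false := by
  rw [show [true] = encodeNat 1 from rfl, ← decodeNat_eq_iff_canonF, ← decodeBool_eq_headD, intOfCode]
  split_ifs with h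
  · simp only [h]
    constructor
    · intro h1; omega
    · rintro ⟨-, h2⟩; exact absurd h2 (by decide)
  · simp [h]

/-- `intOfCode v = 0` iff the magnitude reads `0`. [folklore] -/
theorem intOfCode_eq_zero_iff (v : List Bool) : intOfCode v = 0 ↔ canonF (sndP v) = [] := by
  rw [show ([] : List Bool) = encodeNat 0 from rfl, ← decodeNat_eq_iff_canonF, intOfCode]
  split_ifs <;> simp

/-! ### The tests of the transcoder -/

/-- **Test A**, `[codeDim w = codeFuel w]`: the canonical form of the header against the binary
length of the fuel. [folklore] -/
def chkDim : List Bool → List Bool := eqPairFn ∘ fanoutFn (canonF ∘ fstF) (lenBinF ∘ fstF ∘ sndF)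

/-- Value of test A. [folklore] -/
theorem chkDim_apply (w : List Bool) : chkDim w = [decide (codeDim w = codeFuel w)] := by
  simp only [chkDim, Function.comp_apply, fanoutFn_apply, eqPairFn_boolPair, lenBinF_apply, fstF_eq_fstP,
    sndF_eq_sndP]
  rw [Bool.decide_congr (decodeNat_eq_iff_canonF _ _).symm]
  rfl

/-- `chkDim ∈ FP`. [folklore] -/
theorem chkDim_mem_FP : chkDim ∈ FP :=
  comp_mem_FP eqPairFn_mem_FP (fanoutFn_mem_FP (comp_mem_FP canonF_mem_FP fstF_mem_FP)
    (comp_mem_FP lenBinF_mem_FP (comp_mem_FP fstF_mem_FP sndF_mem_FP)))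

/-- `chkDim` is one-bit. [folklore] -/
theorem oneBit_chkDim : OneBit chkDim := fun w => ⟨_, chkDim_apply w⟩

/-- **The row test** on `⟨u, 1ⁱ⟩`: `[ |fuel of row i| = codeFuel u ]`. [folklore] -/
def rowOK : List Bool → List Bool :=
  eqPairFn ∘ fanoutFn (lenBinF ∘ fstF ∘ elemFn ∘ fanoutFn sndF (sndF ∘ sndF ∘ fstF))
    (lenBinF ∘ fstF ∘ sndF ∘ fstF)

/-- Value of the row test. [folklore] -/
theorem rowOK_apply (u : List Bool) (i : ℕ) :
    rowOK (boolPair u (ones i)) = [decide ((fstP (elemOf (codeRows u) i)).length = codeFuel u)] := by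
  simp only [rowOK, Function.comp_apply, fanoutFn_apply, fstF_eq_fstP, sndF_eq_sndP, fstP_boolPair,
    sndP_boolPair, elemFn_boolPair, List.length_replicate, eqPairFn_boolPair, lenBinF_apply, codeRows, codeFuel]
  congr 1
  apply Bool.decide_congr
  exact ⟨fun h => by simpa using congrArg decodeNat h, fun h => by rw [h]⟩

/-- The row test is one-bit. [folklore] -/
theorem oneBit_rowOK : OneBit rowOK := fun z => by
  unfold rowOK
  rcases eqPairFn_eq_or (fanoutFn (lenBinF ∘ fstF ∘ elemFn ∘ fanoutFn sndF (sndF ∘ sndF ∘ fstF))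
    (lenBinF ∘ fstF ∘ sndF ∘ fstF) z) with h | h
  · exact ⟨true, h⟩
  · exact ⟨false, h⟩

/-- `rowOK ∈ FP`. [folklore] -/
theorem rowOK_mem_FP : rowOK ∈ FP :=
  comp_mem_FP eqPairFn_mem_FP (fanoutFn_mem_FP
    (comp_mem_FP lenBinF_mem_FP (comp_mem_FP fstF_mem_FP (comp_mem_FP elemFn_mem_FP
      (fanoutFn_mem_FP sndF_mem_FP (comp_mem_FP sndF_mem_FP (comp_mem_FP sndF_mem_FP fstF_mem_FP))))))
    (comp_mem_FP lenBinF_mem_FP (comp_mem_FP fstF_mem_FP (comp_mem_FP sndF_mem_FP fstF_mem_FP))))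

/-- The fuel string is within the input. [folklore] -/
theorem length_fuel_le (u : List Bool) : ((fstF ∘ sndF) u).length ≤ u.length := by
  have h1 := length_fstF_sndF_le u
  have h2 := length_fstF_sndF_le (sndF u)
  simp only [Function.comp_apply]
  omega

/-- **Test B**, `[every row i < codeFuel w has fuel codeFuel w]`. [folklore] -/
def chkRows : List Bool → List Bool := allIdxFn (fstF ∘ sndF) rowOK

/-- Value of test B. [folklore] -/
theorem chkRows_apply (u : List Bool) :
    chkRows u = [decide (∀ i < codeFuel u, (fstP (elemOf (codeRows u) i)).length = codeFuel u)] := by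
  rw [chkRows, allIdxFn_apply oneBit_rowOK (length_fuel_le u)]
  simp only [rowOK_apply, List.cons.injEq, and_true, decide_eq_true_eq]
  rfl

/-- `chkRows ∈ FP`. [folklore] -/
theorem chkRows_mem_FP : chkRows ∈ FP :=
  allIdxFn_mem_FP (comp_mem_FP fstF_mem_FP sndF_mem_FP) rowOK_mem_FP oneBit_rowOK

/-- `chkRows` is one-bit. [folklore] -/
theorem oneBit_chkRows : OneBit chkRows := oneBit_allIdxFn oneBit_rowOK length_fuel_le

/-- **The entry accessor** on `⟨⟨u, 1ⁱ⟩, 1ʲ⟩`: the code of entry `(i, j)`. [folklore] -/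
def entryS : List Bool → List Bool :=
  elemFn ∘ fanoutFn sndF (sndF ∘ elemFn ∘ fanoutFn (sndF ∘ fstF) (sndF ∘ sndF ∘ fstF ∘ fstF))

/-- Value of the entry accessor. [folklore] -/
theorem entryS_apply (u : List Bool) (i j : ℕ) :
    entryS (boolPair (boolPair u (ones i)) (ones j)) = codeEntry u i j := by
  simp only [entryS, Function.comp_apply, fanoutFn_apply, fstF_eq_fstP, sndF_eq_sndP, fstP_boolPair,
    sndP_boolPair, elemFn_boolPair, List.length_replicate, codeEntry, codeRows]

/-- `entryS ∈ FP`. [folklore] -/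
theorem entryS_mem_FP : entryS ∈ FP :=
  comp_mem_FP elemFn_mem_FP (fanoutFn_mem_FP sndF_mem_FP (comp_mem_FP sndF_mem_FP (comp_mem_FP elemFn_mem_FP
    (fanoutFn_mem_FP (comp_mem_FP sndF_mem_FP fstF_mem_FP)
      (comp_mem_FP sndF_mem_FP (comp_mem_FP sndF_mem_FP (comp_mem_FP fstF_mem_FP fstF_mem_FP)))))))

/-- **The test `[intOfCode v = 1]`** on an entry code `v`. [folklore] -/
def isOneS : List Bool → List Bool :=
  andFn (eqPairFn ∘ fanoutFn (canonF ∘ sndF) (fun _ => [true])) (notFn (HashBricks.headBitFn ∘ fstF))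

/-- Value of the `= 1` test. [folklore] -/
theorem isOneS_apply (v : List Bool) : isOneS v = [decide (intOfCode v = 1)] := by
  rw [isOneS, andFn_apply (b := decide (canonF (sndP v) = [true])) (b' := !((fstP v).headD false))]
  · rw [Bool.decide_congr (intOfCode_eq_one_iff v), Bool.decide_and]
    cases (fstP v).headD false <;> simp
  · simp [fanoutFn_apply, eqPairFn_boolPair, sndF_eq_sndP]
  · rw [notFn_apply (b := (fstP v).headD false)]
    simp [fstF_eq_fstP]

/-- `isOneS ∈ FP`. [folklore] -/
theorem isOneS_mem_FP : isOneS ∈ FP :=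
  andFn_mem_FP (comp_mem_FP eqPairFn_mem_FP (fanoutFn_mem_FP (comp_mem_FP canonF_mem_FP sndF_mem_FP)
    (const_mem_FP _))) (notFn_mem_FP (comp_mem_FP HashBricks.headBitFn_mem_FP fstF_mem_FP))

/-- **The test `[intOfCode v ∈ {0, 1}]`** on an entry code `v`. [folklore] -/
def is01S : List Bool → List Bool := orFn (isNilFn ∘ canonF ∘ sndF) isOneS

/-- Value of the `0/1` test. [folklore] -/
theorem is01S_apply (v : List Bool) : is01S v = [decide (intOfCode v = 0 ∨ intOfCode v = 1)] := by
  rw [is01S, orFn_apply (b := decide (canonF (sndP v) = [])) (b' := decide (intOfCode v = 1))]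
  · rw [Bool.decide_or, Bool.decide_congr (intOfCode_eq_zero_iff v)]
  · simp [isNilFn, sndF_eq_sndP]
  · exact isOneS_apply v

/-- `is01S` is one-bit. [folklore] -/
theorem oneBit_is01S : OneBit is01S := fun v => ⟨_, is01S_apply v⟩

/-- `is01S ∈ FP`. [folklore] -/
theorem is01S_mem_FP : is01S ∈ FP :=
  orFn_mem_FP (comp_mem_FP isNilFn_mem_FP (comp_mem_FP canonF_mem_FP sndF_mem_FP)) isOneS_mem_FP

/-- The fuel string read off the first field is within the input. [folklore] -/
theorem length_fuel_fstF_le (z : List Bool) : ((fstF ∘ sndF ∘ fstF) z).length ≤ z.length := by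
  have h0 := length_fstF_sndF_le z
  have h1 := length_fuel_le (fstF z)
  simp only [Function.comp_apply] at h1 ⊢
  omega

/-- **The `0/1` row test** on `⟨u, 1ⁱ⟩`: `[every entry (i, j), j < codeFuel u, is 0 or 1]`. [folklore] -/
def row01 : List Bool → List Bool := allIdxFn (fstF ∘ sndF ∘ fstF) (is01S ∘ entryS)

/-- Value of the `0/1` row test. [folklore] -/
theorem row01_apply (u : List Bool) (i : ℕ) :
    row01 (boolPair u (ones i)) = [decide (∀ j < codeFuel u,
      intOfCode (codeEntry u i j) = 0 ∨ intOfCode (codeEntry u i j) = 1)] := by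
  rw [row01, allIdxFn_apply (oneBit_is01S.comp entryS) (length_fuel_fstF_le _)]
  simp only [Function.comp_apply, fstF_boolPair, sndF_eq_sndP, entryS_apply, is01S_apply, List.cons.injEq,
    and_true, decide_eq_true_eq]
  rfl

/-- The `0/1` row test is one-bit. [folklore] -/
theorem oneBit_row01 : OneBit row01 :=
  oneBit_allIdxFn (oneBit_is01S.comp entryS) length_fuel_fstF_le

/-- `row01 ∈ FP`. [folklore] -/
theorem row01_mem_FP : row01 ∈ FP :=
  allIdxFn_mem_FP (comp_mem_FP fstF_mem_FP (comp_mem_FP sndF_mem_FP fstF_mem_FP))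
    (comp_mem_FP is01S_mem_FP entryS_mem_FP) (oneBit_is01S.comp entryS)

/-- **Test C**, `[all entries (i, j), i, j < codeFuel w, are 0 or 1]`. [folklore] -/
def chk01 : List Bool → List Bool := allIdxFn (fstF ∘ sndF) row01

/-- Value of test C. [folklore] -/
theorem chk01_apply (u : List Bool) :
    chk01 u = [decide (∀ i < codeFuel u, ∀ j < codeFuel u,
      intOfCode (codeEntry u i j) = 0 ∨ intOfCode (codeEntry u i j) = 1)] := by
  rw [chk01, allIdxFn_apply oneBit_row01 (length_fuel_le u)]
  simp only [row01_apply, List.cons.injEq, and_true, decide_eq_true_eq]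
  rfl

/-- `chk01 ∈ FP`. [folklore] -/
theorem chk01_mem_FP : chk01 ∈ FP :=
  allIdxFn_mem_FP (comp_mem_FP fstF_mem_FP sndF_mem_FP) row01_mem_FP oneBit_row01

/-- `chk01` is one-bit. [folklore] -/
theorem oneBit_chk01 : OneBit chk01 := oneBit_allIdxFn oneBit_row01 length_fuel_le

/-! ### The output loops -/

/-- The initial record `⟨x, ⟨bin |k x|, ⟨1⁰, ε⟩⟩⟩` of a concatenation fold with `|k x|` rounds. [folklore] -/
def setupS (k : List Bool → List Bool) : List Bool → List Bool :=
  fanoutFn id (fanoutFn (lenBinF ∘ k) fun _ => boolPair [] [])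

/-- Value of the initial record. [folklore] -/
theorem setupS_apply (k : List Bool → List Bool) (x : List Bool) :
    setupS k x = boolPair x (boolPair (encodeNat (k x).length) (boolPair (ones 0) [])) := by
  simp [setupS]

/-- `setupS k ∈ FP` for `k ∈ FP`. [folklore] -/
theorem setupS_mem_FP {k : List Bool → List Bool} (hk : k ∈ FP) : setupS k ∈ FP :=
  fanoutFn_mem_FP OracleCompose.id_mem_FP (fanoutFn_mem_FP (comp_mem_FP lenBinF_mem_FP hk) (const_mem_FP _))

/-- **The row word** on `⟨u, 1ⁱ⟩`: the bits `[entry (i, j) = 1]`, `j < codeFuel u`, concatenated. [folklore] -/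
def rowWordS : List Bool → List Bool :=
  sndPow 2 ∘ foldLoop appF (clipF 1 (isOneS ∘ entryS)) Polynomial.X ∘ setupS (fstF ∘ sndF ∘ fstF)

/-- Value of the row word. [folklore] -/
theorem rowWordS_apply (u : List Bool) (i : ℕ) :
    rowWordS (boolPair u (ones i)) = ccat (fun j => [codeBit u i j]) (codeFuel u) := by
  have hk : (fstF (sndF (fstF (boolPair u (ones i))))).length = codeFuel u := by
    simp [fstF_eq_fstP, sndF_eq_sndP, codeFuel]
  have hle : codeFuel u ≤ (Polynomial.X : Polynomial ℕ).eval (boolPair u (ones i)).length := by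
    rw [Polynomial.eval_X, length_boolPair]
    have := length_fuel_le u
    simp only [Function.comp_apply] at this
    unfold codeFuel; rw [← fstF_eq_fstP, ← sndF_eq_sndP]; omega
  simp only [rowWordS, Function.comp_apply, setupS_apply]
  rw [hk, foldLoop_apply _ _ hle, sndPow_succ_boolPair, sndPow_succ_boolPair, sndPow_zero_boolPair,
    foldAcc_clipF (fun j _ _ => by simp [isOneS_apply]), foldAcc_appF]
  simp only [List.nil_append, Nat.zero_add, Function.comp_apply, entryS_apply, isOneS_apply]
  rfl

/-- The row word is short: `codeFuel u ≤ |u|` letters. [folklore] -/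
theorem length_rowWordS (u : List Bool) (i : ℕ) : (rowWordS (boolPair u (ones i))).length ≤ u.length := by
  rw [rowWordS_apply, length_row_plainWord']
  · have := length_fuel_le u
    simp only [Function.comp_apply] at this
    unfold codeFuel; rw [← fstF_eq_fstP, ← sndF_eq_sndP]; exact this
where
  /-- rows of bits have the fuel as length -/
  length_row_plainWord' : (ccat (fun j => [codeBit u i j]) (codeFuel u)).length = codeFuel u := by
    rw [ccat_singleton, List.length_ofFn]

/-- `rowWordS ∈ FP`. [folklore] -/
theorem rowWordS_mem_FP : rowWordS ∈ FP :=
  comp_mem_FP (sndPow_mem_FP 2) (comp_mem_FP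
    (foldLoop_clipF_mem_FP 1 appF_mem_FP length_appF_le (comp_mem_FP isOneS_mem_FP entryS_mem_FP) _)
    (setupS_mem_FP (comp_mem_FP fstF_mem_FP (comp_mem_FP sndF_mem_FP fstF_mem_FP))))

/-- **The matrix word**: the row words, `i < codeFuel u`, concatenated. [folklore] -/
def wordS : List Bool → List Bool :=
  sndPow 2 ∘ foldLoop appF (clipF 1 rowWordS) Polynomial.X ∘ setupS (fstF ∘ sndF)

/-- Value of the matrix word. [folklore] -/
theorem wordS_apply (u : List Bool) :
    wordS u = ccat (fun i => ccat (fun j => [codeBit u i j]) (codeFuel u)) (codeFuel u) := by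
  have hk : (fstF (sndF u)).length = codeFuel u := by simp [fstF_eq_fstP, sndF_eq_sndP, codeFuel]
  have hle : codeFuel u ≤ (Polynomial.X : Polynomial ℕ).eval u.length := by
    rw [Polynomial.eval_X, ← hk]; exact length_fuel_le u
  simp only [wordS, Function.comp_apply, setupS_apply]
  rw [hk, foldLoop_apply _ _ hle, sndPow_succ_boolPair, sndPow_succ_boolPair, sndPow_zero_boolPair,
    foldAcc_clipF (fun j _ _ => (length_rowWordS u j).trans (by omega)), foldAcc_appF]
  simp only [List.nil_append, Nat.zero_add, rowWordS_apply]

/-- `wordS ∈ FP`. [folklore] -/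
theorem wordS_mem_FP : wordS ∈ FP :=
  comp_mem_FP (sndPow_mem_FP 2) (comp_mem_FP
    (foldLoop_clipF_mem_FP 1 appF_mem_FP length_appF_le rowWordS_mem_FP _)
    (setupS_mem_FP (comp_mem_FP fstF_mem_FP sndF_mem_FP)))

/-! ### The transcoder -/

/-- **The transcoder `toPlainFn`**: if the three tests pass, the matrix word, else `00`. [folklore] -/
def toPlainFn : List Bool → List Bool :=
  iteFn (andFn chkDim (andFn chkRows chk01)) wordS fun _ => [false, false]

/-- **`toPlainFn ∈ FP`.** [cite: AroraBarak2009, §1.3] -/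
theorem toPlainFn_mem_FP : toPlainFn ∈ FP :=
  iteFn_mem_FP (andFn_mem_FP chkDim_mem_FP (andFn_mem_FP chkRows_mem_FP chk01_mem_FP)) wordS_mem_FP
    (const_mem_FP _)

/-- **The transcoder meets its specification** on every string. [folklore] -/
theorem toPlainFn_apply (w : List Bool) : toPlainFn w = toPlainSpec w := by
  have hc : andFn chkDim (andFn chkRows chk01) w = [decide (IsZeroOneCode w)] := by
    rw [andFn_apply (chkDim_apply w) (andFn_apply (chkRows_apply w) (chk01_apply w)), ← Bool.decide_and,
      ← Bool.decide_and]
    congr 1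
    apply Bool.decide_congr
    unfold IsZeroOneCode CodeOK
    constructor
    · rintro ⟨h1, h2, h3⟩
      rw [← h1] at *
      exact ⟨⟨h1.symm, h2⟩, h3⟩
    · rintro ⟨⟨h1, h2⟩, h3⟩
      rw [h1] at *
      exact ⟨h1.symm ▸ rfl, h2, h3⟩
  rw [toPlainFn, iteFn_apply hc, toPlainSpec]
  by_cases h : IsZeroOneCode w
  · rw [decide_eq_true h, if_pos h]
    show wordS w = plainWord w
    rw [wordS_apply, plainWord, h.1.1]
  · rw [decide_eq_false h, if_neg h]
    rfl

/-- **`per01PlainFn ∘ toPlainFn = per01Fn`.** [cite: Valiant1979, Thm. 1] -/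
theorem per01PlainFn_toPlainFn (w : List Bool) : per01PlainFn (toPlainFn w) = per01Fn w := by
  rw [toPlainFn_apply, per01PlainFn_toPlainSpec]

/-! ### Consequences: the structured-code oracle reduces to the row-major oracle -/

/-- The `per01Fn`-oracle is the `per01PlainFn`-oracle after the transcoder. [folklore] -/
theorem ofFun_per01Fn_eq : Oracle.ofFun per01Fn = Oracle.ofFun per01PlainFn ∘ toPlainFn := by
  funext w
  simp [Oracle.ofFun, per01PlainFn_toPlainFn]

/-- **`per01Fn ∈ FP^{per01PlainFn}`** (one query through the transcoder). [cite: Valiant1979, Thm. 1] -/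
theorem ofFun_per01Fn_mem_FPRel : Oracle.ofFun per01Fn ∈ FPRel (Oracle.ofFun per01PlainFn) := by
  rw [ofFun_per01Fn_eq]
  exact comp_FP_mem_FPRel (self_mem_FPRel _) toPlainFn_mem_FP

/-- **`FP^{per01Fn} ⊆ FP^{per01PlainFn}`.** [cite: AroraBarak2009, §17.2] -/
theorem FPRel_per01Fn_subset : FPRel (Oracle.ofFun per01Fn) ⊆ FPRel (Oracle.ofFun per01PlainFn) :=
  OracleAlg.FPRel_subset_FPRel_of_mem_FPRel ofFun_per01Fn_mem_FPRel

/-- **`P^{per01Fn} ⊆ P^{per01PlainFn}`.** [cite: AroraBarak2009, §17.2] -/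
theorem PRel_per01Fn_subset : PRel (Oracle.ofFun per01Fn) ⊆ PRel (Oracle.ofFun per01PlainFn) :=
  OracleAlg.PRel_subset_PRel_of_mem_FPRel ofFun_per01Fn_mem_FPRel

/-- **`#P`-hardness transfers from the structured to the row-major transcription.** [cite: Valiant1979, Thm. 1] -/
theorem isSharpPHardFun_per01Plain_of_per01Fn (h : IsSharpPHardFun per01Fn) : IsSharpPHardFun per01PlainFn :=
  fun f hf => FPRel_per01Fn_subset (h f hf)

/-- **The QuantumComplexity transcription of Valiant's theorem implies the AlgebraicComplexity
one**: `permanent01_isSharpPHardFun → Valiant1979_per01Plain_isSharpPHardFun`. [cite: Valiant1979, Thm. 1] -/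
theorem Valiant1979_per01Plain_isSharpPHardFun_of_permanent01 (h : permanent01_isSharpPHardFun) :
    Valiant1979_per01Plain_isSharpPHardFun :=
  isSharpPHardFun_per01Plain_of_per01Fn h

/-! ### The converse transcoder: row-major words to structured codes -/

/-- The structured code built from a row-major word (the easy direction: ENCODE): for a word of
square length `n²` the `encodingIntMatrix`-code of its `0/1` matrix, otherwise the code of the
`1 × 1` zero matrix (permanent `0`). [folklore] -/
def toCodeSpec (w : List Bool) : List Bool :=
  if Nat.sqrt w.length * Nat.sqrt w.length = w.length then
    encodingIntMatrix.encode ⟨Nat.sqrt w.length, fun i j =>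
      if w.getD (i.val * Nat.sqrt w.length + j.val) false then 1 else 0⟩
  else encodingIntMatrix.encode ⟨1, fun _ _ => 0⟩

/-- **The specified converse transcoder is correct**: `per01Fn (toCodeSpec w) = per01PlainFn w`. [cite: Valiant1979, Thm. 1] -/
theorem per01Fn_toCodeSpec (w : List Bool) : per01Fn (toCodeSpec w) = per01PlainFn w := by
  unfold toCodeSpec per01PlainFn
  split_ifs with h
  · rw [per01Fn_encode _ (fun i j => by
      cases w.getD (i.val * Nat.sqrt w.length + j.val) false <;> simp)]
    rfl
  · rw [per01Fn_encode _ (fun _ _ => Or.inl rfl)]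
    have : (Matrix.of fun (_ : Fin 1) (_ : Fin 1) => (0 : ℤ)) = 0 := by ext; rfl
    rw [this, Matrix.permanent_zero]
    rfl

/-- **The list payload of `listBool` is a `ccat`**: folding `boolPair ∘ R` over
`[f 0, …, f (n-1)]` from `ε` gives `ccat (i ↦ ⟨R (f i), ε⟩) n`. [folklore] -/
theorem foldr_boolPair_comp_ofFn {α : Type} (R : α → List Bool) (f : ℕ → α) :
    ∀ n : ℕ, (List.ofFn fun i : Fin n => f i).foldr (fun a acc => boolPair (R a) acc) [] =
      ccat (fun i => boolPair (R (f i)) []) n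
  | 0 => rfl
  | n + 1 => by
    rw [List.ofFn_succ', List.concat_eq_append, List.foldr_append, List.foldr_cons, List.foldr_nil]
    simp only [Fin.val_castSucc, Fin.val_last]
    have key : ∀ (l : List α) (init : List Bool), l.foldr (fun a acc => boolPair (R a) acc) init =
        l.foldr (fun a acc => boolPair (R a) acc) [] ++ init := by
      intro l init
      induction l with
      | nil => rfl
      | cons a t ih => simp only [List.foldr_cons, ih]; simp [boolPair]
    rw [key, foldr_boolPair_comp_ofFn R f n, ccat_succ]

/-- The entry code of the bit at position `k` of `w` (sign `+`, magnitude `[bit]` or `ε`). [folklore] -/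
def bitCode (w : List Bool) (k : ℕ) : List Bool := boolPair [false] (if w.getD k false then [true] else [])

/-- The entry code of the matrix entry `[bit k of w]`. [folklore] -/
theorem encodingIntBool_encode_bit (w : List Bool) (k : ℕ) :
    encodingIntBool.encode (if w.getD k false then 1 else 0) = bitCode w k := by
  unfold bitCode; split_ifs <;> rfl

/-- The row code of row `i` of the `n × n` matrix of a word: fuel `1ⁿ` and the entry codes. [folklore] -/
def rowCode (w : List Bool) (n i : ℕ) : List Bool :=
  boolPair (ones n) (ccat (fun j => boolPair (bitCode w (i * n + j)) []) n)

/-- **The structured code of the `n × n` matrix of a word, flat**: header `bin n`, fuel `1ⁿ`, and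
the `ccat` of the row codes. [folklore] -/
theorem encode_sq_eq (w : List Bool) (n : ℕ) :
    encodingIntMatrix.encode ⟨n, fun i j => if w.getD (i.val * n + j.val) false then 1 else 0⟩ =
      boolPair (encodeNat n) (boolPair (ones n) (ccat (fun i => boolPair (rowCode w n i) []) n)) := by
  have h1 := foldr_boolPair_comp_ofFn
    (fun a : Fin n → ℤ => boolPair (List.replicate n true)
      ((List.ofFn a).foldr (fun b acc => boolPair (encodingIntBool.encode b) acc) []))
    (fun (i : ℕ) (j : Fin n) => if w.getD (i * n + j.val) false then (1 : ℤ) else 0) n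
  have h2 : ∀ i : ℕ, (List.ofFn fun j : Fin n => if w.getD (i * n + j.val) false then (1 : ℤ) else 0).foldr
      (fun b acc => boolPair (encodingIntBool.encode b) acc) [] =
      ccat (fun j => boolPair (bitCode w (i * n + j)) []) n := fun i => by
    refine (foldr_boolPair_comp_ofFn (fun b : ℤ => encodingIntBool.encode b)
      (fun j : ℕ => if w.getD (i * n + j) false then (1 : ℤ) else 0) n).trans ?_
    congr 1
    funext j
    rw [encodingIntBool_encode_bit]
  simp only [h2] at h1
  simp only [encodingIntMatrix, Encoding.sigmaBool, encodingFinVec, Encoding.listBool,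
    OracleCompose.unaryEncodeNat_eq_replicate, List.length_ofFn]
  exact congrArg (boolPair (encodeNat n)) (congrArg (boolPair (List.replicate n true)) h1)

/-! ### The converse transcoder as an `FP` brick -/

/-- The dimension in unary, `1^{⌊√|w|⌋}` (bounded conversion with the word itself as ruler). [folklore] -/
def nUnS : List Bool → List Bool := binToUnaryFn ∘ fanoutFn id isqrtFn

/-- Value of the unary dimension. [folklore] -/
theorem nUnS_apply (w : List Bool) : nUnS w = ones (Nat.sqrt w.length) := by
  simp [nUnS, min_eq_left (Nat.sqrt_le_self _)]

/-- `nUnS ∈ FP`. [folklore] -/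
theorem nUnS_mem_FP : nUnS ∈ FP :=
  comp_mem_FP binToUnaryFn_mem_FP (fanoutFn_mem_FP OracleCompose.id_mem_FP isqrtFn_mem_FP)

/-- **The square test** `[⌊√|w|⌋² = |w|]`. [folklore] -/
def sqTestS : List Bool → List Bool := eqPairFn ∘ fanoutFn (prodFn ∘ fanoutFn isqrtFn isqrtFn) lenBinF

/-- Value of the square test. [folklore] -/
theorem sqTestS_apply (w : List Bool) :
    sqTestS w = [decide (Nat.sqrt w.length * Nat.sqrt w.length = w.length)] := by
  simp only [sqTestS, Function.comp_apply, fanoutFn_apply, prodFn_boolPair, isqrtFn_apply, bitsToNat_encodeNat,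
    lenBinF_apply, eqPairFn_boolPair]
  congr 1
  apply Bool.decide_congr
  exact ⟨fun h => by simpa using congrArg decodeNat h, fun h => by rw [h]⟩

/-- `sqTestS ∈ FP`. [folklore] -/
theorem sqTestS_mem_FP : sqTestS ∈ FP :=
  comp_mem_FP eqPairFn_mem_FP (fanoutFn_mem_FP (comp_mem_FP prodFn_mem_FP (fanoutFn_mem_FP isqrtFn_mem_FP
    isqrtFn_mem_FP)) lenBinF_mem_FP)

/-- On `⟨⟨w, 1ⁱ⟩, 1ʲ⟩`: the numeral of the position `i ⌊√|w|⌋ + j`. [folklore] -/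
def posS : List Bool → List Bool :=
  addFn ∘ fanoutFn (prodFn ∘ fanoutFn (lenBinF ∘ sndF ∘ fstF) (isqrtFn ∘ fstF ∘ fstF)) (lenBinF ∘ sndF)

/-- Value of the position numeral. [folklore] -/
theorem posS_apply (w : List Bool) (i j : ℕ) :
    posS (boolPair (boolPair w (ones i)) (ones j)) = encodeNat (i * Nat.sqrt w.length + j) := by
  simp [posS]

/-- `posS ∈ FP`. [folklore] -/
theorem posS_mem_FP : posS ∈ FP :=
  comp_mem_FP addFn_mem_FP (fanoutFn_mem_FP (comp_mem_FP prodFn_mem_FP (fanoutFn_mem_FP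
    (comp_mem_FP lenBinF_mem_FP (comp_mem_FP sndF_mem_FP fstF_mem_FP))
    (comp_mem_FP isqrtFn_mem_FP (comp_mem_FP fstF_mem_FP fstF_mem_FP)))) (comp_mem_FP lenBinF_mem_FP sndF_mem_FP))

/-- On `⟨⟨w, 1ⁱ⟩, 1ʲ⟩`: the letter of `w` at the position (`take 1 ∘ drop`). [folklore] -/
def letterS : List Bool → List Bool :=
  bitAtFn ∘ fanoutFn (binToUnaryFn ∘ fanoutFn (fstF ∘ fstF) posS) (fstF ∘ fstF)

/-- Value of the letter accessor. [folklore] -/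
theorem letterS_apply (w : List Bool) (i j : ℕ) :
    letterS (boolPair (boolPair w (ones i)) (ones j)) =
      (w.drop (min (i * Nat.sqrt w.length + j) w.length)).take 1 := by
  simp only [letterS, Function.comp_apply, fanoutFn_apply, fstF_boolPair, posS_apply, binToUnaryFn_boolPair,
    bitsToNat_encodeNat, bitAtFn_boolPair, List.length_replicate]

/-- `letterS ∈ FP`. [folklore] -/
theorem letterS_mem_FP : letterS ∈ FP :=
  comp_mem_FP bitAtFn_mem_FP (fanoutFn_mem_FP (comp_mem_FP binToUnaryFn_mem_FP
    (fanoutFn_mem_FP (comp_mem_FP fstF_mem_FP fstF_mem_FP) posS_mem_FP)) (comp_mem_FP fstF_mem_FP fstF_mem_FP))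

/-- The letter at a position, read by `take 1 ∘ drop` with the position capped at the length, is
`[1]` iff the word has the letter `1` there. [folklore] -/
theorem take_one_drop_min_eq_iff (w : List Bool) (k : ℕ) :
    (w.drop (min k w.length)).take 1 = [true] ↔ w.getD k false = true := by
  by_cases hk : k < w.length
  · rw [min_eq_left hk.le, List.take_one_drop_eq_of_lt_length hk, List.getD_eq_getElem _ _ hk]
    simp
  · rw [min_eq_right (not_lt.1 hk), List.drop_length, List.getD_eq_default _ _ (not_lt.1 hk)]
    simp

/-- On `⟨⟨w, 1ⁱ⟩, 1ʲ⟩`: **the entry code** `bitCode w (i ⌊√|w|⌋ + j)`. [folklore] -/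
def entC : List Bool → List Bool :=
  fanoutFn (fun _ => [false]) (iteFn (eqPairFn ∘ fanoutFn letterS fun _ => [true]) (fun _ => [true]) fun _ => [])

/-- Value of the entry code brick. [folklore] -/
theorem entC_apply (w : List Bool) (i j : ℕ) :
    entC (boolPair (boolPair w (ones i)) (ones j)) = bitCode w (i * Nat.sqrt w.length + j) := by
  have hc : (eqPairFn ∘ fanoutFn letterS fun _ => [true]) (boolPair (boolPair w (ones i)) (ones j)) =
      [w.getD (i * Nat.sqrt w.length + j) false] := by
    simp only [Function.comp_apply, fanoutFn_apply, letterS_apply, eqPairFn_boolPair]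
    congr 1
    rw [← Bool.decide_eq_true (b := w.getD _ false)]
    exact Bool.decide_congr (take_one_drop_min_eq_iff w _)
  rw [entC, fanoutFn_apply, iteFn_apply hc, bitCode]

/-- `entC ∈ FP`. [folklore] -/
theorem entC_mem_FP : entC ∈ FP :=
  fanoutFn_mem_FP (const_mem_FP _) (iteFn_mem_FP (comp_mem_FP eqPairFn_mem_FP
    (fanoutFn_mem_FP letterS_mem_FP (const_mem_FP _))) (const_mem_FP _) (const_mem_FP _))

/-- Entry codes are short: at most `5` letters. [folklore] -/
theorem length_bitCode_le (w : List Bool) (k : ℕ) : (bitCode w k).length ≤ 5 := by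
  unfold bitCode; split_ifs <;> simp

/-- On `⟨w, 1ⁱ⟩`: **the row code** `rowCode w ⌊√|w|⌋ i`. [folklore] -/
def rowC : List Bool → List Bool :=
  fanoutFn (nUnS ∘ fstF)
    (sndPow 2 ∘ foldLoop appF (clipF 12 (fanoutFn entC fun _ => [])) Polynomial.X ∘ setupS (nUnS ∘ fstF))

/-- Value of the row code brick. [folklore] -/
theorem rowC_apply (w : List Bool) (i : ℕ) :
    rowC (boolPair w (ones i)) = rowCode w (Nat.sqrt w.length) i := by
  have hk : (nUnS (fstF (boolPair w (ones i)))).length = Nat.sqrt w.length := by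
    simp [nUnS_apply]
  have hle : Nat.sqrt w.length ≤ (Polynomial.X : Polynomial ℕ).eval (boolPair w (ones i)).length := by
    rw [Polynomial.eval_X, length_boolPair]
    exact (Nat.sqrt_le_self _).trans (by omega)
  simp only [rowC, Function.comp_apply, fanoutFn_apply, setupS_apply]
  rw [hk, foldLoop_apply _ _ hle, sndPow_succ_boolPair, sndPow_succ_boolPair, sndPow_zero_boolPair,
    foldAcc_clipF (fun j _ _ => by
      rw [fanoutFn_apply, entC_apply, length_boolPair]
      have := length_bitCode_le w (i * Nat.sqrt w.length + j)
      simp only [List.length_nil]; omega), foldAcc_appF]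
  simp only [List.nil_append, Nat.zero_add, fanoutFn_apply, entC_apply, fstF_boolPair, nUnS_apply, rowCode]

/-- `rowC ∈ FP`. [folklore] -/
theorem rowC_mem_FP : rowC ∈ FP :=
  fanoutFn_mem_FP (comp_mem_FP nUnS_mem_FP fstF_mem_FP) (comp_mem_FP (sndPow_mem_FP 2) (comp_mem_FP
    (foldLoop_clipF_mem_FP 12 appF_mem_FP length_appF_le (fanoutFn_mem_FP entC_mem_FP (const_mem_FP _)) _)
    (setupS_mem_FP (comp_mem_FP nUnS_mem_FP fstF_mem_FP))))

/-- Row codes have length `≤ 14 |w| + 2`. [folklore] -/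
theorem length_rowCode_le (w : List Bool) (i : ℕ) :
    (rowCode w (Nat.sqrt w.length) i).length ≤ 14 * w.length + 2 := by
  unfold rowCode
  rw [length_boolPair, List.length_replicate]
  have h1 := length_ccat_le (fun j => boolPair (bitCode w (i * Nat.sqrt w.length + j)) []) 12
    (fun j => by rw [length_boolPair]; have := length_bitCode_le w (i * Nat.sqrt w.length + j); simp; omega)
    (Nat.sqrt w.length)
  have h2 := Nat.sqrt_le_self w.length
  nlinarith

/-- **The matrix code** of a word (header, fuel, rows). [folklore] -/
def matC : List Bool → List Bool :=
  fanoutFn isqrtFn (fanoutFn nUnS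
    (sndPow 2 ∘ foldLoop appF (clipF 34 (fanoutFn rowC fun _ => [])) Polynomial.X ∘ setupS nUnS))

/-- Value of the matrix code brick: the structured code of the `⌊√|w|⌋ × ⌊√|w|⌋` matrix of `w`. [folklore] -/
theorem matC_apply (w : List Bool) :
    matC w = encodingIntMatrix.encode ⟨Nat.sqrt w.length, fun i j =>
      if w.getD (i.val * Nat.sqrt w.length + j.val) false then 1 else 0⟩ := by
  have hk : (nUnS w).length = Nat.sqrt w.length := by simp [nUnS_apply]
  have hle : Nat.sqrt w.length ≤ (Polynomial.X : Polynomial ℕ).eval w.length := by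
    rw [Polynomial.eval_X]; exact Nat.sqrt_le_self _
  rw [encode_sq_eq]
  simp only [matC, Function.comp_apply, fanoutFn_apply, setupS_apply, isqrtFn_apply]
  rw [hk, foldLoop_apply _ _ hle, sndPow_succ_boolPair, sndPow_succ_boolPair, sndPow_zero_boolPair,
    foldAcc_clipF (fun j _ _ => by
      rw [fanoutFn_apply, rowC_apply, length_boolPair]
      have := length_rowCode_le w j
      simp only [List.length_nil]; omega), foldAcc_appF]
  simp only [List.nil_append, Nat.zero_add, fanoutFn_apply, rowC_apply, nUnS_apply]

/-- `matC ∈ FP`. [folklore] -/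
theorem matC_mem_FP : matC ∈ FP :=
  fanoutFn_mem_FP isqrtFn_mem_FP (fanoutFn_mem_FP nUnS_mem_FP (comp_mem_FP (sndPow_mem_FP 2) (comp_mem_FP
    (foldLoop_clipF_mem_FP 34 appF_mem_FP length_appF_le (fanoutFn_mem_FP rowC_mem_FP (const_mem_FP _)) _)
    (setupS_mem_FP nUnS_mem_FP))))

/-- **The converse transcoder `toCodeFn`**: the matrix code of a word of square length, the code
of the `1 × 1` zero matrix otherwise. [folklore] -/
def toCodeFn : List Bool → List Bool :=
  iteFn sqTestS matC fun _ => encodingIntMatrix.encode ⟨1, fun _ _ => 0⟩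

/-- **`toCodeFn ∈ FP`.** [cite: AroraBarak2009, §1.3] -/
theorem toCodeFn_mem_FP : toCodeFn ∈ FP := iteFn_mem_FP sqTestS_mem_FP matC_mem_FP (const_mem_FP _)

/-- **The converse transcoder meets its specification.** [folklore] -/
theorem toCodeFn_apply (w : List Bool) : toCodeFn w = toCodeSpec w := by
  rw [toCodeFn, iteFn_apply (sqTestS_apply w), toCodeSpec]
  by_cases h : Nat.sqrt w.length * Nat.sqrt w.length = w.length
  · rw [decide_eq_true h, if_pos h, if_pos rfl, matC_apply]
  · rw [decide_eq_false h, if_neg h]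
    rfl

/-- **`per01Fn ∘ toCodeFn = per01PlainFn`.** [cite: Valiant1979, Thm. 1] -/
theorem per01Fn_toCodeFn (w : List Bool) : per01Fn (toCodeFn w) = per01PlainFn w := by
  rw [toCodeFn_apply, per01Fn_toCodeSpec]

/-! ### Consequences: the two transcriptions are equivalent -/

/-- The `per01PlainFn`-oracle is the `per01Fn`-oracle after the converse transcoder. [folklore] -/
theorem ofFun_per01PlainFn_eq : Oracle.ofFun per01PlainFn = Oracle.ofFun per01Fn ∘ toCodeFn := by
  funext w
  simp [Oracle.ofFun, per01Fn_toCodeFn]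

/-- **`per01PlainFn ∈ FP^{per01Fn}`.** [cite: Valiant1979, Thm. 1] -/
theorem ofFun_per01PlainFn_mem_FPRel : Oracle.ofFun per01PlainFn ∈ FPRel (Oracle.ofFun per01Fn) := by
  rw [ofFun_per01PlainFn_eq]
  exact comp_FP_mem_FPRel (self_mem_FPRel _) toCodeFn_mem_FP

/-- **`FP^{per01PlainFn} = FP^{per01Fn}`.** [cite: AroraBarak2009, §17.2] -/
theorem FPRel_per01Plain_eq : FPRel (Oracle.ofFun per01PlainFn) = FPRel (Oracle.ofFun per01Fn) :=
  Set.Subset.antisymm (OracleAlg.FPRel_subset_FPRel_of_mem_FPRel ofFun_per01PlainFn_mem_FPRel)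
    FPRel_per01Fn_subset

/-- **`P^{per01PlainFn} = P^{per01Fn}`.** [cite: AroraBarak2009, §17.2] -/
theorem PRel_per01Plain_eq : PRel (Oracle.ofFun per01PlainFn) = PRel (Oracle.ofFun per01Fn) :=
  Set.Subset.antisymm (OracleAlg.PRel_subset_PRel_of_mem_FPRel ofFun_per01PlainFn_mem_FPRel)
    PRel_per01Fn_subset

/-- **`#P`-hardness of the row-major `0/1` permanent is `#P`-hardness of the structured one.** [cite: Valiant1979, Thm. 1] -/
theorem isSharpPHardFun_per01Plain_iff : IsSharpPHardFun per01PlainFn ↔ IsSharpPHardFun per01Fn := by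
  unfold IsSharpPHardFun IsSharpPHard
  rw [FPRel_per01Plain_eq]

/-- **The two transcriptions of Valiant's theorem in the tree are equivalent**:
`Valiant1979_per01Plain_isSharpPHardFun ↔ permanent01_isSharpPHardFun`. [cite: Valiant1979, Thm. 1] -/
theorem Valiant1979_per01Plain_isSharpPHardFun_iff_permanent01 :
    Valiant1979_per01Plain_isSharpPHardFun ↔ permanent01_isSharpPHardFun :=
  isSharpPHardFun_per01Plain_iff

/-- **The AlgebraicComplexity transcription implies the QuantumComplexity one.** [cite: Valiant1979, Thm. 1] -/
theorem permanent01_isSharpPHardFun_of_per01Plain (h : Valiant1979_per01Plain_isSharpPHardFun) :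
    permanent01_isSharpPHardFun :=
  isSharpPHardFun_per01Plain_iff.1 h

end Literature.Computability.AlgebraicComplexity
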